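import Mathlib
import Summits.ValiantsHypothesis.ValiantsHypothesis.Theorems.FifoMatchingNNDivisionHardFewArcFaces
import HarnessLib

/-!
# Route FifoMatching — crux `NNDivisionHard` (stmt-ValiantsHypothesis-21181): FACES AVOIDING UP TO `√n` ARBITRARY ARCS ARE
# HARD — the HALVING recursion; cofactors generic for some arc set of size `≤ √n` are not certificates

`…FewArcFaces.lean` removed one arc per recursion step (bounded `|I|`).  Halving does better: split `[0, 2n)` in the middle and
KEEP THE HALF WITH FEWER INTERNAL ARCS — crossing arcs vanish, the other half's arcs cost one avoiding matching there
(`…FewArcsAvoidable`), and the kept half carries `< |I|/2` arcs.  After `r` rounds (`|I| < 2^r`) the face is a full `NN_m` with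
`n < 2^r (m + 2)`, i.e. `m ≳ n / (2|I|)`:

* `card_preimages_add_le` — `|I_L| + |I_R| ≤ |I|`;
* ★★ `halvingFaces_exp_lower_bound` — **for every `r`: if `2^r (n_E + 16) ≤ n` and `|I| < 2^r` then some `m` with
  `n < 2^r (m + 2)` has `2^{m^{1/6}} ≤ L₊(NN_n^{¬I}) + 3r`** (`n_E` the threshold of `NNMonotoneExpBound.exp_lower_bound`);
* ★★ `sqrtArcFaces_qp_hard` — **for every `c`, eventually in `n`: for every arc set `I` with `(|I| + 1)² ≤ n` and every `L`,
  `L₊(NN_n^{¬I}) ≤ 16((2n+1)(L+2))² ⇒ 2^((log₂ n + c)^c) < L`;**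
* ★★ `sqrtArcsGeneric_not_certificate_qp` — **for every `c`, eventually in `n`: a cofactor whose outer face `top_{𝟙_{I^c}} h` is
  a single monomial for SOME arc set `I` with `(|I| + 1)² ≤ n` satisfies `2^((log₂ n + c)^c) < L₊(NN_n · h) + L₊(h)`** — e.g.
  every positive power sum of up to `√n` distinct perfect matchings, every degree.

HONEST FRAMING: a genericity tier for ONE candidate; symmetric cofactors (no separating arc set of size `≤ √n`) untouched;
stmt-21181 stays OPEN; nothing here bears on `NNNotVP` or on VP ≠ VNP (NOT proved).  No definitions, no named facts.
References: Hrubeš–Yehudayoff 2021 §6 Problem 2 [HrubesYehudayoff2021]; Bürgisser 2000 Rem. 2.7 [Burgisser2000].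
-/

noncomputable section

-- Sub = Summit single-conjunct layout: the duplicated namespace component is mandated by the tree.
set_option linter.dupNamespace false
set_option autoImplicit false

namespace Summit.ValiantsHypothesis.ValiantsHypothesis.Theorems.FifoMatching.NNDivisionHard.ManyArcFaces

open Finset MvPolynomial Literature.Computability.AlgebraicComplexity
open Summit.ValiantsHypothesis.ValiantsHypothesis.Theorems.ZeroOneTransfer.Negative (topComponent)
open Summit.ValiantsHypothesis.ValiantsHypothesis.Theorems.FifoMatching.NNDivisionHard.StackPowersQueue
  (blockEmb blockEmb_injective)
open Summit.ValiantsHypothesis.ValiantsHypothesis.Theorems.FifoMatching.NNDivisionHard.SplitFace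
  (shiftR blockEmbR two_mul_le val_shiftR blockEmbR_injective)
open Summit.ValiantsHypothesis.ValiantsHypothesis.Theorems.FifoMatching.NNDivisionHard.ArcElimination
  (complexity_avoidingFace_le_of_top_monomial)
open Summit.ValiantsHypothesis.ValiantsHypothesis.Theorems.FifoMatching.NNDivisionHard.BinomialPowers
  (absorb_arith absorb_exp)
open Summit.ValiantsHypothesis.ValiantsHypothesis.Theorems.FifoMatching.NNDivisionHard.FewArcsAvoidable
  (exists_nestFree_avoiding_of_card_le)
open Summit.ValiantsHypothesis.ValiantsHypothesis.Theorems.FifoMatching.NNDivisionHard.FewArcFaces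
  (stepL stepR face_empty)
open scoped NNReal BigOperators

/-! ### §1 The two internal arc sets are disjointly embedded in `I` -/

section Blocks

variable {b c : ℕ}

/-- `|I_L| + |I_R| ≤ |I|`: the left- and right-internal arcs of `I` are disjoint parts of `I`. [folklore] -/
theorem card_preimages_add_le (I : Finset (Fin (2 * (b + c)) × Fin (2 * (b + c)))) :
    ((Finset.univ : Finset (Fin (2 * b) × Fin (2 * b))).filter (fun a => blockEmb (two_mul_le b c) a ∈ I)).card +
      ((Finset.univ : Finset (Fin (2 * c) × Fin (2 * c))).filter (fun a => blockEmbR b c a ∈ I)).card ≤ I.card := by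
  classical
  set SL := ((Finset.univ : Finset (Fin (2 * b) × Fin (2 * b))).filter
    (fun a => blockEmb (two_mul_le b c) a ∈ I)).image (blockEmb (two_mul_le b c)) with hSL
  set SR := ((Finset.univ : Finset (Fin (2 * c) × Fin (2 * c))).filter
    (fun a => blockEmbR b c a ∈ I)).image (blockEmbR b c) with hSR
  have hL : SL.card = ((Finset.univ : Finset (Fin (2 * b) × Fin (2 * b))).filter
      (fun a => blockEmb (two_mul_le b c) a ∈ I)).card :=
    Finset.card_image_of_injective _ (blockEmb_injective (two_mul_le b c))
  have hR : SR.card = ((Finset.univ : Finset (Fin (2 * c) × Fin (2 * c))).filter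
      (fun a => blockEmbR b c a ∈ I)).card :=
    Finset.card_image_of_injective _ blockEmbR_injective
  have hdisj : Disjoint SL SR := by
    rw [Finset.disjoint_left]
    intro p hpL hpR
    rw [hSL, Finset.mem_image] at hpL
    rw [hSR, Finset.mem_image] at hpR
    obtain ⟨a, -, rfl⟩ := hpL
    obtain ⟨a', -, hEq⟩ := hpR
    have := congrArg (fun q => ((q.1 : Fin (2 * (b + c))) : ℕ)) hEq
    simp only [blockEmb, blockEmbR, Prod.map_fst, Fin.val_castLE, val_shiftR] at this
    have := a.1.isLt
    omega
  have hsub : SL ∪ SR ⊆ I := by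
    intro p hp
    rcases Finset.mem_union.1 hp with h | h
    · rw [hSL, Finset.mem_image] at h
      obtain ⟨a, ha, rfl⟩ := h
      exact (Finset.mem_filter.1 ha).2
    · rw [hSR, Finset.mem_image] at h
      obtain ⟨a, ha, rfl⟩ := h
      exact (Finset.mem_filter.1 ha).2
  have := Finset.card_le_card hsub
  rw [Finset.card_union_of_disjoint hdisj] at this
  omega

end Blocks

/-! ### §2 The halving recursion -/

/-- ★★ **HALVING RECURSION.**  With `n_E` the threshold of `NNMonotoneExpBound.exp_lower_bound`: for every `r`, every `n` with
`2^r (n_E + 16) ≤ n` and every arc set `I` with `|I| < 2^r`, some `m` with `n < 2^r (m + 2)` has `2^{m^{1/6}} ≤ L₊(NN_n^{¬I}) + 3r`.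
[cite: HrubesYehudayoff2021, §6 Problem 2] [cite: Burgisser2000, Rem. 2.7] -/
theorem halvingFaces_exp_lower_bound : ∃ nE : ℕ, ∀ r n : ℕ, 2 ^ r * (nE + 16) ≤ n →
    ∀ I : Finset (Fin (2 * n) × Fin (2 * n)), I.card < 2 ^ r →
    ∃ m : ℕ, n < 2 ^ r * (m + 2) ∧ (2 : ℝ) ^ ((m : ℝ) ^ ((1 : ℝ) / 6)) ≤
      ((complexity (∑ M ∈ (nestFreeMatchings (2 * n)).filter (fun M => ∀ j ∈ openers M, (j, M j) ∉ I),
        arcMonomial ℝ≥0 M) + 3 * r : ℕ) : ℝ) := by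
  classical
  obtain ⟨nE, hnE⟩ := NNMonotoneExpBound.exp_lower_bound
  refine ⟨nE, fun r => ?_⟩
  induction r with
  | zero =>
    intro n hn I hI
    refine ⟨n, by omega, ?_⟩
    obtain rfl : I = ∅ := Finset.card_eq_zero.1 (by simpa using hI)
    rw [face_empty]
    exact (hnE n (by omega)).trans (by exact_mod_cast Nat.le_add_right _ _)
  | succ r ih =>
    intro n hn I hI
    -- the middle boundary
    obtain ⟨b, hb⟩ : ∃ b : ℕ, b = n / 2 := ⟨_, rfl⟩
    have hbn : b ≤ n := by omega
    obtain ⟨c, hc⟩ := Nat.exists_eq_add_of_le hbn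
    subst hc
    have hX : 2 ^ (r + 1) * (nE + 16) = 2 * (2 ^ r * (nE + 16)) := by ring
    have hpow : 2 ^ (r + 1) = 2 * 2 ^ r := by ring
    rw [hX] at hn
    rw [hpow] at hI
    have hb' : 2 ^ r * (nE + 16) ≤ b := by omega
    have hc' : 2 ^ r * (nE + 16) ≤ c := by omega
    have h2r : 1 ≤ 2 ^ r := Nat.one_le_two_pow
    have h16 : 2 ^ r * 16 ≤ 2 ^ r * (nE + 16) := Nat.mul_le_mul_left _ (by omega)
    have hbI : 2 * I.card + 3 ≤ b := by omega
    have hcI : 2 * I.card + 3 ≤ c := by omega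
    have hsum := card_preimages_add_le I
    have em : ∀ m : ℕ, 2 ^ (r + 1) * (m + 2) = 2 * (2 ^ r * (m + 2)) := fun m => by ring
    set IL := (Finset.univ : Finset (Fin (2 * b) × Fin (2 * b))).filter
      (fun a => blockEmb (two_mul_le b c) a ∈ I) with hIL
    set IR := (Finset.univ : Finset (Fin (2 * c) × Fin (2 * c))).filter (fun a => blockEmbR b c a ∈ I) with hIR
    have hL := exists_nestFree_avoiding_of_card_le (k := IL.card) (c := b) (by omega) IL le_rfl
    have hR := exists_nestFree_avoiding_of_card_le (k := IR.card) (c := c) (by omega) IR le_rfl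
    by_cases hside : IL.card ≤ IR.card
    · -- keep the left half
      have hILr : IL.card < 2 ^ r := by omega
      have hstep := stepL I hL hR
      obtain ⟨m, hm, hexp⟩ := ih b hb' IL hILr
      refine ⟨m, by rw [em m]; omega, hexp.trans ?_⟩
      have := Nat.add_le_add_right hstep (3 * r)
      exact_mod_cast this.trans (le_of_eq (by ring))
    · -- keep the right half
      have hIRr : IR.card < 2 ^ r := by omega
      have hstep := stepR I hL hR
      obtain ⟨m, hm, hexp⟩ := ih c hc' IR hIRr
      refine ⟨m, by rw [em m]; omega, hexp.trans ?_⟩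
      have := Nat.add_le_add_right hstep (3 * r)
      exact_mod_cast this.trans (le_of_eq (by ring))

/-! ### §3 Quasi-polynomial currency at `|I| ≤ √n` -/

/-- `(log₂ n + K)^K < m^{1/6}` eventually, uniformly in `n ≤ 4 (m + 2)²`. [folklore] -/
theorem polylog_lt_rpow_sq_eventually (K : ℕ) : ∃ n₀ : ℕ, ∀ n : ℕ, n₀ ≤ n → ∀ m : ℕ, n ≤ 4 * (m + 2) ^ 2 →
    (((Nat.log 2 n + K) ^ K : ℕ) : ℝ) < (m : ℝ) ^ ((1 : ℝ) / 6) := by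
  obtain ⟨n₂, hn₂⟩ := CorSandwich.polylog_lt_rpow_eventually (2 * K + 6) (c := 1 / 6) (by norm_num)
  refine ⟨4 * (n₂ + 4) ^ 2, fun n hn m hm => ?_⟩
  have hm2 : n₂ + 2 ≤ m := by
    have h1 : (n₂ + 4) ^ 2 ≤ (m + 2) ^ 2 := by omega
    have h2 := (Nat.pow_le_pow_iff_left (by norm_num : (2 : ℕ) ≠ 0)).1 h1
    omega
  have hm1 : 2 ≤ m := by omega
  have h := hn₂ m (by omega)
  -- `log₂ n ≤ 2 log₂ m + 5`
  have hlt : n < 2 ^ (2 * Nat.log 2 m + 6) := by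
    have h1 : m < 2 ^ (Nat.log 2 m + 1) := Nat.lt_pow_succ_log_self one_lt_two m
    have h2 : m + 2 ≤ 2 * m := by omega
    have h3 : (m + 2) ^ 2 ≤ (2 * m) ^ 2 := Nat.pow_le_pow_left h2 2
    have h4 : (2 * m) ^ 2 < (2 * 2 ^ (Nat.log 2 m + 1)) ^ 2 :=
      Nat.pow_lt_pow_left (by omega) (by norm_num)
    have h5 : (2 * 2 ^ (Nat.log 2 m + 1)) ^ 2 = 2 ^ (2 * Nat.log 2 m + 4) := by ring
    have h6 : 4 * 2 ^ (2 * Nat.log 2 m + 4) = 2 ^ (2 * Nat.log 2 m + 6) := by ring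
    omega
  have hlog : Nat.log 2 n < 2 * Nat.log 2 m + 6 := Nat.log_lt_of_lt_pow' (by omega) hlt
  have hsq : (Nat.log 2 n + K) ^ K ≤ (Nat.log 2 m + (2 * K + 6)) ^ (2 * K + 6) := by
    have hx : Nat.log 2 n + K ≤ 2 * (Nat.log 2 m + K + 3) := by omega
    have hy : 2 * (Nat.log 2 m + K + 3) ≤ (Nat.log 2 m + K + 3) ^ 2 := by
      rw [pow_two]
      exact Nat.mul_le_mul_right _ (by omega)
    calc (Nat.log 2 n + K) ^ K ≤ ((Nat.log 2 m + K + 3) ^ 2) ^ K := Nat.pow_le_pow_left (hx.trans hy) K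
      _ = (Nat.log 2 m + K + 3) ^ (2 * K) := by rw [← pow_mul]
      _ ≤ (Nat.log 2 m + (2 * K + 6)) ^ (2 * K) := Nat.pow_le_pow_left (by omega) _
      _ ≤ (Nat.log 2 m + (2 * K + 6)) ^ (2 * K + 6) := Nat.pow_le_pow_right (by omega) (by omega)
  exact lt_of_le_of_lt (by exact_mod_cast hsq) h

/-- `x^K + 3x ≤ (x + 3)^(K + 1)` for `x, K ≥ 1`. [folklore] -/
theorem pow_add_three_mul_le (x K : ℕ) (hx : 1 ≤ x) (hK : 1 ≤ K) : x ^ K + 3 * x ≤ (x + 3) ^ (K + 1) := by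
  have h1 : x ≤ x ^ K := by
    calc x = x ^ 1 := (pow_one x).symm
      _ ≤ x ^ K := Nat.pow_le_pow_right hx hK
  have h2 : x ^ K ≤ (x + 3) ^ K := Nat.pow_le_pow_left (by omega) K
  calc x ^ K + 3 * x ≤ x ^ K + 3 * x ^ K := by omega
    _ = 4 * x ^ K := by ring
    _ ≤ (x + 3) * x ^ K := Nat.mul_le_mul_right _ (by omega)
    _ ≤ (x + 3) * (x + 3) ^ K := Nat.mul_le_mul_left _ h2
    _ = (x + 3) ^ (K + 1) := by ring

/-- `P + Q ≤ P · Q` for `P, Q ≥ 2`. [folklore] -/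
theorem add_le_mul_of_two_le (P Q : ℕ) (hP : 2 ≤ P) (hQ : 2 ≤ Q) : P + Q ≤ P * Q := by nlinarith

/-- ★★ **FACES AVOIDING UP TO `√n` ARCS, quasi-polynomial currency.**  For every `c`, eventually in `n`: for every arc set `I`
with `(|I| + 1)² ≤ n` and every `L`, `L₊(NN_n^{¬I}) ≤ 16 ((2n+1)(L+2))² ⇒ 2^((log₂ n + c)^c) < L`.
[cite: HrubesYehudayoff2021, §6 Problem 2] -/
theorem sqrtArcFaces_qp_hard (c : ℕ) : ∃ n₀ : ℕ, ∀ n : ℕ, n₀ ≤ n →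
    ∀ I : Finset (Fin (2 * n) × Fin (2 * n)), (I.card + 1) ^ 2 ≤ n → ∀ L : ℕ,
    complexity (∑ M ∈ (nestFreeMatchings (2 * n)).filter (fun M => ∀ j ∈ openers M, (j, M j) ∉ I),
      arcMonomial ℝ≥0 M) ≤ 16 * ((2 * n + 1) * (L + 2)) ^ 2 → 2 ^ ((Nat.log 2 n + c) ^ c) < L := by
  set K : ℕ := c + 14 with hK
  obtain ⟨nE, hrec⟩ := halvingFaces_exp_lower_bound
  obtain ⟨n₃, hn₃⟩ := polylog_lt_rpow_sq_eventually (K + 4)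
  refine ⟨max (4 * (nE + 16) ^ 2) (max n₃ 2), fun n hn I hI L hface => ?_⟩
  have hn1 : 4 * (nE + 16) ^ 2 ≤ n := le_trans (le_max_left _ _) hn
  have hn3 : n₃ ≤ n := le_trans (le_trans (le_max_left _ _) (le_max_right _ _)) hn
  have hn2 : 2 ≤ n := le_trans (le_trans (le_max_right _ _) (le_max_right _ _)) hn
  set F := complexity (∑ M ∈ (nestFreeMatchings (2 * n)).filter (fun M => ∀ j ∈ openers M, (j, M j) ∉ I),
      arcMonomial ℝ≥0 M) with hF
  -- the number of rounds: `2^r = 2 · 2^{log₂ (|I|+1)}`, so `|I| < 2^r ≤ 2 (|I| + 1)`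
  set r : ℕ := Nat.log 2 (I.card + 1) + 1 with hr
  have hr1 : I.card + 1 < 2 ^ r := Nat.lt_pow_succ_log_self one_lt_two _
  have hr2 : 2 ^ r ≤ 2 * (I.card + 1) := by
    rw [hr, pow_succ]
    have := Nat.pow_log_le_self 2 (show I.card + 1 ≠ 0 by omega)
    omega
  -- size condition `2^r (nE + 16) ≤ n`: `2^r ≤ 2(|I|+1) ≤ 2√n` and `2√n (nE+16) ≤ n` for `n ≥ 4(nE+16)²`
  have hsize : 2 ^ r * (nE + 16) ≤ n := by
    have h1 : 2 ^ r * (nE + 16) ≤ 2 * (I.card + 1) * (nE + 16) := Nat.mul_le_mul_right _ hr2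
    have h2 : (2 * (I.card + 1) * (nE + 16)) * (2 * (I.card + 1) * (nE + 16)) ≤ n * n := by
      have : (2 * (I.card + 1) * (nE + 16)) * (2 * (I.card + 1) * (nE + 16)) =
          (4 * (nE + 16) ^ 2) * (I.card + 1) ^ 2 := by ring
      rw [this]
      exact Nat.mul_le_mul hn1 hI
    have h3 : 2 * (I.card + 1) * (nE + 16) ≤ n := by
      by_contra hlt
      push Not at hlt
      have := Nat.mul_lt_mul_of_lt_of_lt hlt hlt
      omega
    exact h1.trans h3
  obtain ⟨m, hm, hexp⟩ := hrec r n hsize I (by omega)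
  -- `n ≤ 4 (m + 2)²`
  have hm4 : n ≤ 4 * (m + 2) ^ 2 := by
    have h1 : n < 2 * (I.card + 1) * (m + 2) := lt_of_lt_of_le hm (Nat.mul_le_mul_right _ hr2)
    have h2 : n * n < (2 * (I.card + 1) * (m + 2)) * (2 * (I.card + 1) * (m + 2)) :=
      Nat.mul_lt_mul_of_lt_of_lt h1 h1
    have h3 : (2 * (I.card + 1) * (m + 2)) * (2 * (I.card + 1) * (m + 2)) =
        (4 * (m + 2) ^ 2) * (I.card + 1) ^ 2 := by ring
    rw [h3] at h2
    by_contra hlt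
    push Not at hlt
    have h4 : (4 * (m + 2) ^ 2) * (I.card + 1) ^ 2 < n * (I.card + 1) ^ 2 :=
      Nat.mul_lt_mul_of_pos_right hlt (by positivity)
    have h5 : n * (I.card + 1) ^ 2 ≤ n * n := Nat.mul_le_mul_left _ hI
    omega
  -- `3r ≤ 3 (log₂ n + 1)`
  have hr3 : r ≤ Nat.log 2 n + 1 := by
    rw [hr]
    have h1 : I.card + 1 ≤ (I.card + 1) ^ 2 := Nat.le_self_pow (by norm_num) _
    have : Nat.log 2 (I.card + 1) ≤ Nat.log 2 n := Nat.log_mono_right (h1.trans hI)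
    omega
  by_contra hle
  push Not at hle
  have e1 := absorb_arith n c L hle
  have e3 : 2 ^ (2 * (Nat.log 2 n + c) ^ c + 2 * Nat.log 2 n + 13) ≤ 2 ^ ((Nat.log 2 n + K) ^ K) :=
    Nat.pow_le_pow_right (by norm_num) (absorb_exp (Nat.log 2 n) c)
  have h7 := e1.trans e3
  -- `(ℓ + K)^K + 3r + 2 ≤ (ℓ + K + 4)^(K + 4)`
  have hp : (Nat.log 2 n + K) ^ K + 3 * r + 2 ≤ (Nat.log 2 n + (K + 4)) ^ (K + 4) := by
    have hx : 1 ≤ Nat.log 2 n + K := by omega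
    have h1 := pow_add_three_mul_le (Nat.log 2 n + K) K hx (by omega)
    have ha : (Nat.log 2 n + K + 3) ^ (K + 1) ≤ (Nat.log 2 n + (K + 4)) ^ (K + 1) :=
      Nat.pow_le_pow_left (by omega) _
    have hc3 : 3 ≤ (Nat.log 2 n + (K + 4)) ^ 3 :=
      calc 3 ≤ 3 ^ 1 := by norm_num
        _ ≤ (Nat.log 2 n + (K + 4)) ^ 1 := Nat.pow_le_pow_left (by omega) 1
        _ ≤ (Nat.log 2 n + (K + 4)) ^ 3 := Nat.pow_le_pow_right (by omega) (by norm_num)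
    have h2 : (Nat.log 2 n + (K + 4)) ^ (K + 1) * 3 ≤ (Nat.log 2 n + (K + 4)) ^ (K + 4) :=
      calc (Nat.log 2 n + (K + 4)) ^ (K + 1) * 3
          ≤ (Nat.log 2 n + (K + 4)) ^ (K + 1) * (Nat.log 2 n + (K + 4)) ^ 3 := Nat.mul_le_mul_left _ hc3
        _ = (Nat.log 2 n + (K + 4)) ^ (K + 4) := by rw [← pow_add]
    have h3 : 3 * r ≤ 3 * (Nat.log 2 n + K) := by omega
    omega
  -- abbreviate the big quantities
  obtain ⟨X, hX⟩ : ∃ X : ℕ, ((2 * n + 1) * (L + 2)) ^ 2 = X := ⟨_, rfl⟩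
  obtain ⟨P, hP⟩ : ∃ P : ℕ, 2 ^ ((Nat.log 2 n + K) ^ K) = P := ⟨_, rfl⟩
  obtain ⟨Q, hQ⟩ : ∃ Q : ℕ, 2 ^ (3 * r + 2) = Q := ⟨_, rfl⟩
  have hX1 : 1 ≤ X := by
    rw [← hX]; exact Nat.one_le_pow _ _ (Nat.mul_pos (by omega) (by omega))
  rw [hX, hP] at h7
  rw [hX] at hface
  have hP2 : 2 ≤ P := by omega
  have hQ2 : 2 ≤ Q := by
    rw [← hQ]
    calc 2 = 2 ^ 1 := (pow_one 2).symm
      _ ≤ 2 ^ (3 * r + 2) := Nat.pow_le_pow_right (by norm_num) (by omega)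
  have hQr : 3 * r + 1 ≤ Q := by
    rw [← hQ]
    have := Nat.lt_two_pow_self (n := 3 * r + 2)
    omega
  have key : P + Q ≤ P * Q := add_le_mul_of_two_le P Q hP2 hQ2
  have h8 : 16 * X + 3 * r + 1 ≤ 2 ^ ((Nat.log 2 n + (K + 4)) ^ (K + 4)) :=
    calc 16 * X + 3 * r + 1 ≤ P + Q := by omega
      _ ≤ P * Q := key
      _ = 2 ^ ((Nat.log 2 n + K) ^ K + 3 * r + 2) := by rw [← hP, ← hQ]; ring
      _ ≤ 2 ^ ((Nat.log 2 n + (K + 4)) ^ (K + 4)) := Nat.pow_le_pow_right (by norm_num) hp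
  have h2 := hn₃ n hn3 m hm4
  have h3 : (2 : ℝ) ^ ((((Nat.log 2 n + (K + 4)) ^ (K + 4) : ℕ) : ℝ)) < (2 : ℝ) ^ ((m : ℝ) ^ ((1 : ℝ) / 6)) :=
    Real.rpow_lt_rpow_of_exponent_lt (by norm_num) h2
  have h4 : ((2 ^ ((Nat.log 2 n + (K + 4)) ^ (K + 4)) : ℕ) : ℝ) < ((F + 3 * r : ℕ) : ℝ) := by
    rw [Nat.cast_pow, Nat.cast_ofNat, ← Real.rpow_natCast]
    exact h3.trans_le hexp
  have h5 : 2 ^ ((Nat.log 2 n + (K + 4)) ^ (K + 4)) < F + 3 * r := by exact_mod_cast h4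
  have h9 : F + 3 * r < 16 * X + 3 * r + 1 := by omega
  exact absurd (lt_trans h5 (lt_of_lt_of_le h9 h8)) (lt_irrefl _)

/-- ★★ **COFACTORS GENERIC FOR SOME ARC SET OF SIZE `≤ √n − 1` ARE NOT CERTIFICATES.**  For every `c`, eventually in `n`: if for
some arc set `I` with `(|I| + 1)² ≤ n` the outer face `top_{𝟙_{I^c}} h` is a single monomial `a · x^d` (`a ≠ 0`), then
`2^((log₂ n + c)^c) < L₊(NN_n · h) + L₊(h)`. [cite: HrubesYehudayoff2021, §6 Problem 2] [cite: JuknaSeiwertSergeev2022, Thm 1] -/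
theorem sqrtArcsGeneric_not_certificate_qp (c : ℕ) : ∃ n₀ : ℕ, ∀ n : ℕ, n₀ ≤ n →
    ∀ I : Finset (Fin (2 * n) × Fin (2 * n)), (I.card + 1) ^ 2 ≤ n →
    ∀ (h : MvPolynomial (Fin (2 * n) × Fin (2 * n)) ℝ≥0) (d : (Fin (2 * n) × Fin (2 * n)) →₀ ℕ) (a : ℝ≥0), a ≠ 0 →
      topComponent (fun v : Fin (2 * n) × Fin (2 * n) => if v ∈ I then 0 else 1) h = monomial d a →
      2 ^ ((Nat.log 2 n + c) ^ c) < complexity (nestFreeMatchingPoly n ℝ≥0 * h) + complexity h := by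
  obtain ⟨n₀, hn₀⟩ := sqrtArcFaces_qp_hard c
  refine ⟨max n₀ 9, fun n hn I hI h d a ha htop => ?_⟩
  have hn9 : 9 ≤ n := le_trans (le_max_right _ _) hn
  have hcard : 2 * I.card + 3 ≤ n := by
    rcases Nat.lt_or_ge I.card 2 with hlt | hge
    · omega
    · have h1 : 3 * (I.card + 1) ≤ (I.card + 1) * (I.card + 1) := Nat.mul_le_mul_right _ (by omega)
      rw [← pow_two] at h1
      omega
  have hIav := exists_nestFree_avoiding_of_card_le (k := I.card) (c := n) hcard I le_rfl
  have hface := complexity_avoidingFace_le_of_top_monomial I hIav ha htop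
  exact lt_of_lt_of_le (hn₀ n (le_trans (le_max_left _ _) hn) I hI _ hface) (Nat.le_add_right _ _)

end Summit.ValiantsHypothesis.ValiantsHypothesis.Theorems.FifoMatching.NNDivisionHard.ManyArcFaces

end
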